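import Summits.ResolutionOfSingularities.ResolutionOfSingularities.Theorems.EquisingularLiftEquisingularLiftNatDirZeroDefs
import Literature.AlgebraicGeometry.Deformation.IdealModulePushforward
import Literature.AlgebraicGeometry.Modules.PushforwardIsoUnit
import Literature.AlgebraicGeometry.Modules.SheafHomLeft
import Literature.AlgebraicGeometry.Morphisms.CechModuleUnit
import HarnessLib

/-!
# [OURS · L1 W4.5(b) · S6 (L) brick C2, sub-brick B0] Transport of `DirStepUnobs` along isomorphic closed-immersion pairs

Cell `res-hironaka`, LADDER-RESOLUTION rung L (D-0089), slot W4.5(b), crux chain w45b: working crux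
`Theses.EquisingularLift.EquisingularLiftNat` (stmt-ResolutionOfSingularities-20038) / child `EquisingularLiftNatThree`
(stmt-ResolutionOfSingularities-20148); brick C2 of res-L1-w45b-stub-4's `Tower.hLift_of_bricks` (the direction-lift socket `hL` of
the TOWER₄ / NOSE₄ / DIR₀₁ plugs at `n = 3`), sub-brick **B0** of res-type-027's C2 cut (`Cruxes/EquisingularLiftNatThree/Lines/
C2-CENSUS-res-type-027.md`, signature file `L/res-type-027/B0-DirStepUnobsTransport.sig.lean` bab7a9673ac92a38), built by
res-L1-w45b-stub-2 g9. `--supports stmt-ResolutionOfSingularities-20148 --as helper`. OURS; NOT a statement of any manuscript;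
AI-written, and AI review is weaker than expert review. No `sorry`, standard axioms, DEF-FREE (every comparison isomorphism is
asserted as `Nonempty (_ ≅ _)`, which is all a `Subsingleton` transport needs).

WHAT. The socket hands the unobstructedness datum `hunobs : DirStepUnobs G E hE Z hZ` (tree `…NatDirZeroDefs`: for the closed
immersion `i : Z̃ ⟶ Ẽ` of reduced structures over `G`, `Ȟ¹` of the normal sheaf `𝒩_{Z̃/Ẽ} = (i^*𝓘)^∨` vanishes on some affine
2-cover of `Z̃`) on the CURRENT stage, together with isomorphisms `ε : Ẽ ⟶ Ẽ₁`, `εZ : Z̃ ⟶ Γ̃₁` onto the reduced structures of the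
root round, compatible with `ϱ : G ⟶ G₁`. Brick C2 computes on `G₁`; this file moves the hypothesis:
* `nonempty_idealModule_iso_of_iso_comp` — SOURCE invariance of the ideal module: `𝓘_{α ≫ i₁} ≅ 𝓘_{i₁}` for an isomorphism `α`
  (kernels of `i₁♯` and `i₁♯ ≫ i₁_*(α♯)`, `α♯` an isomorphism; tree `Deformation.structureModuleMap_comp`);
* `nonempty_pullback_idealModule_iso` — for a commutative square `i ≫ β = α ≫ i₁` with `α`, `β` isomorphisms: `β^* 𝓘_{i₁} ≅ 𝓘_i`
  (tree TARGET invariance `Deformation.idealModulePushforwardIso` + `Modules.pullbackIsoOfIsoPushforward`);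
* `nonempty_pushforward_conormalSheaf_iso`, **`nonempty_pushforward_normalSheaf_iso`** — `(α⁻¹)_* 𝒞_{i₁} ≅ 𝒞_i` and
  `(α⁻¹)_* 𝒩_{i₁} ≅ 𝒩_i` (Mathlib `pullbackComp`/`pullbackCongr`; tree `pullbackInvIsoPushforward`, `dualPushforwardIso`,
  `sheafHomMapLeftIso`);
* `subsingleton_cechMH1_iff_forall`, `subsingleton_cechMH1_iff_of_base` — `Ȟ¹(𝒰; M) = 0` does not depend on the structure map
  `f : X ⟶ Spec A` (the cochains and differentials of `Morphisms/CechModule` are those of `M`; `f` only fixes the scalar action);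
* `subsingleton_cechMH1_of_schemeIso` — `Ȟ¹` vanishing moves along an isomorphism of schemes and an isomorphism
  `(α⁻¹)_* N ≅ M` of modules, to the transported cover `j ↦ (α⁻¹)⁻¹ V_j` (tree `cechMH1PushforwardEquiv`);
* **`dirStepUnobs_transport`** — B0 as cut (binders verbatim from the socket): `DirStepUnobs G E hE Z hZ → DirStepUnobs G₁ E₁ hE₁ Γ₁ hΓ₁`.
  The closed immersion `i : Z̃ ⟶ Ẽ` is Mathlib's `IdealSheafData.inclusion` (`Z ⊆ E`); the square `i ≫ ε = εZ ≫ i₁` holds because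
  `Ẽ₁ ⟶ G₁` is a monomorphism. The hypothesis `Γ₁ ⊆ E₁` of the cut is idle (it follows from the isomorphisms) and is carried `_`-named.

References (index only): The Stacks Project, Tags 08KY (the ideal `Ker(i♯)` of a closed immersion), 01ED (functoriality of the Čech
complex) [cite: StacksProject]; R. Hartshorne, *Algebraic Geometry* (1977), II §5 (direct and inverse images), III Thm. 4.5
[cite: Hartshorne1977]; R.-O. Buchweitz, H. Flenner (2003) §1 (the normal sheaf `𝓗om(𝓘/𝓘², 𝒪_Z)`) [cite: BuchweitzFlenner2003].
-/

noncomputable section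

-- `TopCat.Presheaf`/`Scheme.Modules` are not reducible (as in Mathlib's `AlgebraicGeometry/Modules`).
set_option backward.isDefEq.respectTransparency false

open CategoryTheory CategoryTheory.Limits AlgebraicGeometry TopologicalSpace Opposite
open Literature.AlgebraicGeometry.Deformation (idealModule structureModuleMap structureSheafModule conormalSheaf
  idealModulePushforwardIso structureModuleMap_comp)
open Literature.AlgebraicGeometry.HodgeTheory (normalSheaf)
open Literature.AlgebraicGeometry.Modules
open Literature.AlgebraicGeometry.Morphisms

set_option linter.dupNamespace false -- mandated namespace `Summit.<Summit>.<Problem>` of this single-conjunct summit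

namespace Summit.ResolutionOfSingularities.ResolutionOfSingularities.Cruxes.EquisingularLiftNat.Sections

universe u v

/-! ### The ideal module, the conormal sheaf and the normal sheaf of ISOMORPHIC ARROWS -/

section ArrowIso

variable {Z Z₁ Y Y₁ : Scheme.{u}} (i : Z ⟶ Y) (i₁ : Z₁ ⟶ Y₁) (α : Z ≅ Z₁) (β : Y ≅ Y₁)

/-- **Source invariance of the ideal module**: for an isomorphism `α : Z ≅ Z₁` and any `i₁ : Z₁ ⟶ Y₁`, the ideal module
`𝓘_{α ≫ i₁} = Ker((α ≫ i₁)♯)` is isomorphic to `𝓘_{i₁} = Ker(i₁♯)`: `(α ≫ i₁)♯ = i₁♯ ≫ i₁_*(α♯)` up to `pushforwardComp`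
(tree `structureModuleMap_comp`) and `α♯` is an isomorphism, so the kernels agree (Mathlib `kernelCompMono`).
[cite: StacksProject, Tag 08KY (reading: functoriality of `Ker(i♯)` along an isomorphism of the source)] -/
theorem nonempty_idealModule_iso_of_iso_comp : Nonempty (idealModule (α.hom ≫ i₁) ≅ idealModule i₁) := by
  -- `(α ≫ i₁)♯ = i₁♯ ≫ (i₁_*(α♯) ≫ comparison)`
  have h : structureModuleMap (α.hom ≫ i₁) =
      structureModuleMap i₁ ≫ ((Scheme.Modules.pushforward i₁).map (structureModuleMap α.hom) ≫
        ((Scheme.Modules.pushforwardComp α.hom i₁).app (structureSheafModule Z)).hom) := by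
    rw [← Category.assoc, ← (Iso.comp_inv_eq _).mp (structureModuleMap_comp α.hom i₁)]
  exact ⟨kernelIsoOfEq h ≪≫ kernelCompMono _ _⟩

variable {i i₁ α β}

/-- **Target invariance, pulled back**: for a commutative square `i ≫ β = α ≫ i₁` of schemes with `α : Z ≅ Z₁`, `β : Y ≅ Y₁`
isomorphisms, `β^* 𝓘_{i₁} ≅ 𝓘_i` — from `𝓘_{i₁} ≅ 𝓘_{α ≫ i₁} = 𝓘_{i ≫ β} ≅ β_* 𝓘_i` (source invariance + tree
`idealModulePushforwardIso`) and `β^* β_* ≅ 𝟭` (tree `pullbackIsoOfIsoPushforward`).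
[cite: StacksProject, Tag 08KY (reading: functoriality of `Ker(i♯)` along isomorphisms)] -/
theorem nonempty_pullback_idealModule_iso (hsq : i ≫ β.hom = α.hom ≫ i₁) :
    Nonempty ((Scheme.Modules.pullback β.hom).obj (idealModule i₁) ≅ idealModule i) := by
  obtain ⟨e₁⟩ := nonempty_idealModule_iso_of_iso_comp i₁ α
  have e₂ : idealModule (i ≫ β.hom) ≅ (Scheme.Modules.pushforward β.hom).obj (idealModule i) :=
    idealModulePushforwardIso i β
  rw [hsq] at e₂
  exact ⟨pullbackIsoOfIsoPushforward β (e₁.symm ≪≫ e₂)⟩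

/-- **The conormal sheaves of isomorphic arrows**: `(α⁻¹)_* (i₁^* 𝓘_{i₁}) ≅ i^* 𝓘_i` for a commutative square
`i ≫ β = α ≫ i₁` with `α`, `β` isomorphisms (`(α⁻¹)_* = α^*`, `α^* i₁^* = (α ≫ i₁)^* = (i ≫ β)^* = i^* β^*`, and
`β^* 𝓘_{i₁} ≅ 𝓘_i`). [cite: StacksProject, Tag 08KY (reading: the conormal sheaf `i^*𝓘` along isomorphisms)] -/
theorem nonempty_pushforward_conormalSheaf_iso (hsq : i ≫ β.hom = α.hom ≫ i₁) :
    Nonempty ((Scheme.Modules.pushforward α.inv).obj (conormalSheaf i₁) ≅ conormalSheaf i) := by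
  obtain ⟨e𝓘⟩ := nonempty_pullback_idealModule_iso hsq
  -- `(α⁻¹)_* 𝒞₁ ≅ α^* 𝒞₁ = α^* i₁^* 𝓘₁`
  have e₀ : (Scheme.Modules.pushforward α.inv).obj (conormalSheaf i₁) ≅
      (Scheme.Modules.pullback α.hom).obj ((Scheme.Modules.pullback i₁).obj (idealModule i₁)) :=
    (pullbackInvIsoPushforward α.symm (conormalSheaf i₁)).symm
  -- `α^* i₁^* ≅ (α ≫ i₁)^* = (i ≫ β)^* ≅ i^* β^*`
  have e₃ : (Scheme.Modules.pullback α.hom).obj ((Scheme.Modules.pullback i₁).obj (idealModule i₁)) ≅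
      (Scheme.Modules.pullback i).obj ((Scheme.Modules.pullback β.hom).obj (idealModule i₁)) :=
    (Scheme.Modules.pullbackComp α.hom i₁).app (idealModule i₁) ≪≫
      (Scheme.Modules.pullbackCongr hsq.symm).app (idealModule i₁) ≪≫
        ((Scheme.Modules.pullbackComp i β.hom).app (idealModule i₁)).symm
  exact ⟨e₀ ≪≫ e₃ ≪≫ (Scheme.Modules.pullback i).mapIso e𝓘⟩

/-- **The normal sheaves of isomorphic arrows**: `(α⁻¹)_* 𝒩_{Z₁/Y₁} ≅ 𝒩_{Z/Y}` (`𝒩 = (i^*𝓘)^∨`, tree `HodgeTheory.normalSheaf`)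
for a commutative square `i ≫ β = α ≫ i₁` with `α : Z ≅ Z₁`, `β : Y ≅ Y₁` isomorphisms (duals commute with `(α⁻¹)_*`, tree
`dualPushforwardIso`; then the conormal comparison under `𝓗om(–, 𝒪)`, tree `sheafHomMapLeftIso`).
[cite: BuchweitzFlenner2003, §1 (the normal sheaf 𝓗om(𝓘/𝓘², 𝒪_Z); reading: invariance under isomorphisms of the pair)] -/
theorem nonempty_pushforward_normalSheaf_iso (hsq : i ≫ β.hom = α.hom ≫ i₁) :
    Nonempty ((Scheme.Modules.pushforward α.inv).obj (normalSheaf i₁) ≅ normalSheaf i) := by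
  obtain ⟨e𝒞⟩ := nonempty_pushforward_conormalSheaf_iso hsq
  have e₀ : (Scheme.Modules.pushforward α.inv).obj (normalSheaf i₁) ≅
      dual ((Scheme.Modules.pushforward α.inv).obj (conormalSheaf i₁)) :=
    dualPushforwardIso α.symm (conormalSheaf i₁)
  exact ⟨e₀ ≪≫ sheafHomMapLeftIso e𝒞 (unitModule Z)⟩

end ArrowIso

/-! ### `Ȟ¹(𝒰; M) = 0` is independent of the structure map, and moves along isomorphisms of schemes -/

section Cech

variable {A : Type u} [CommRing A] {X : Scheme.{u}} (f : X ⟶ Spec (.of A)) (M : X.Modules) {ι : Type v} (U : ι → X.Opens)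

/-- `Ȟ¹(𝒰; M) = 0` iff every `1`-cocycle is a coboundary (class form ↔ cochain form). [folklore] -/
theorem subsingleton_cechMH1_iff_forall :
    Subsingleton (CechMH1 f M U) ↔ ∀ c : CechMC1 f M U, cechMD1 f M U c = 0 → ∃ b, cechMD0 f M U b = c := by
  constructor
  · intro h c hc
    exact (mem_cechMB1_iff f M U c).mp
      ((CechMH1.mk_eq_zero_iff f M U ⟨c, (mem_cechMZ1_iff f M U c).mpr hc⟩).mp (Subsingleton.elim _ _))
  · intro h
    refine ⟨fun x y => ?_⟩
    obtain ⟨z, rfl⟩ := CechMH1.mk_surjective f M U x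
    obtain ⟨z', rfl⟩ := CechMH1.mk_surjective f M U y
    rw [CechMH1.mk_eq_mk_iff, mem_cechMB1_iff]
    have hzz' : (z : CechMC1 f M U) - z' ∈ cechMZ1 f M U := Submodule.sub_mem _ z.2 z'.2
    exact h _ ((mem_cechMZ1_iff f M U _).mp hzz')

/-- **`Ȟ¹(𝒰; M) = 0` does not depend on the structure map**: for two structure maps `f : X ⟶ Spec A`, `f' : X ⟶ Spec A'`
(any rings) the Čech cochains, cocycles and coboundaries of `M` on `𝒰` are literally the same (`f` only fixes the scalar
action), so vanishing of `Ȟ¹` for one is vanishing for the other. [folklore] -/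
theorem subsingleton_cechMH1_iff_of_base {A' : Type u} [CommRing A'] (f' : X ⟶ Spec (.of A')) :
    Subsingleton (CechMH1 f M U) ↔ Subsingleton (CechMH1 f' M U) := by
  rw [subsingleton_cechMH1_iff_forall f M U, subsingleton_cechMH1_iff_forall f' M U]
  exact Iff.rfl

/-- **`Ȟ¹` vanishing along an isomorphism of schemes.** For an isomorphism `α : X ≅ X₁`, structure maps with
`α⁻¹ ≫ f = f₁`, modules `N` on `X₁`, `M` on `X` with `(α⁻¹)_* N ≅ M`, and a family of opens `V` of `X`:
`Ȟ¹(V; M) = 0 ⇒ Ȟ¹((α⁻¹)⁻¹V; N) = 0` (tree `cechMH1PushforwardEquiv` + `subsingleton_cechMH1_of_iso`).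
[cite: StacksProject, Tag 01ED (functoriality of the Čech complex)] -/
theorem subsingleton_cechMH1_of_schemeIso {X₁ : Scheme.{u}} (α : X ≅ X₁) (f₁ : X₁ ⟶ Spec (.of A)) (hf : α.inv ≫ f = f₁)
    {N : X₁.Modules} (e : (Scheme.Modules.pushforward α.inv).obj N ≅ M) (h : Subsingleton (CechMH1 f M U)) :
    Subsingleton (CechMH1 f₁ N (preimageFamily α.inv U)) := by
  have h' : Subsingleton (CechMH1 f ((Scheme.Modules.pushforward α.inv).obj N) U) := subsingleton_cechMH1_of_iso f U e h
  exact (cechMH1PushforwardEquiv f U f₁ α.inv hf N).symm.subsingleton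

end Cech

/-! ### B0: transport of `DirStepUnobs` -/

/-- **B0** — `DirStepUnobs` is invariant under isomorphisms of the pair `(Ẽ ⊇ Z̃)`: given isomorphisms `ε : Ẽ ⟶ Ẽ₁`, `εZ : Z̃ ⟶ Γ̃₁` of the
reduced structures compatible with a morphism `ϱ : G ⟶ G₁` of the ambient stages, unobstructedness of `Z` in `E` gives unobstructedness of
`Γ₁` in `E₁`. (Binders verbatim from the socket `Tower.hLift_of_bricks`; the hypothesis `Γ₁ ⊆ E₁` is idle.) PROOF: for the given
`i₁ : Γ̃₁ ⟶ Ẽ₁` over `G₁`, the inclusion `i : Z̃ ⟶ Ẽ` (`Z ⊆ E`, Mathlib `IdealSheafData.inclusion`) satisfies `i ≫ ε = εZ ≫ i₁`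
(`Ẽ₁ ⟶ G₁` is a monomorphism); `hunobs i` gives an affine 2-cover `V` of `Z̃` with `Ȟ¹(V; 𝒩_i) = 0`; transport it to the cover
`j ↦ εZ(V_j) = (εZ⁻¹)⁻¹ V_j` of `Γ̃₁` (affine pieces and overlap, covers) with `(εZ⁻¹)_* 𝒩_{i₁} ≅ 𝒩_i`
(`nonempty_pushforward_normalSheaf_iso`, `subsingleton_cechMH1_of_schemeIso`, `subsingleton_cechMH1_iff_of_base`).
[OURS · L1 W4.5b · C2/B0; replaces nothing printed; NOT a statement of the manuscript] -/
theorem dirStepUnobs_transport (G : Scheme.{0}) (E : Set G) (hE : IsClosed E) (Z : Set G) (hZ : IsClosed Z)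
    (G₁ : Scheme.{0}) (ϱ : G ⟶ G₁) (E₁ : Set G₁) (hE₁ : IsClosed E₁) (Γ₁ : Set G₁) (hΓ₁ : IsClosed Γ₁)
    (ε : redSub G E hE ⟶ redSub G₁ E₁ hE₁) (εZ : redSub G Z hZ ⟶ redSub G₁ Γ₁ hΓ₁)
    (hZE : Z ⊆ E) (_hΓE : Γ₁ ⊆ E₁)
    (hεiso : IsIso ε) (hεcomm : ε ≫ redSubι G₁ E₁ hE₁ = redSubι G E hE ≫ ϱ)
    (hεZiso : IsIso εZ) (hεZcomm : εZ ≫ redSubι G₁ Γ₁ hΓ₁ = redSubι G Z hZ ≫ ϱ)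
    (hunobs : DirStepUnobs G E hE Z hZ) :
    DirStepUnobs G₁ E₁ hE₁ Γ₁ hΓ₁ := by
  intro i₁ hi₁
  -- the inclusion `i : Z̃ ⟶ Ẽ` of reduced closed subschemes (`Z ⊆ E`)
  have hle : Scheme.IdealSheafData.vanishingIdeal (⟨E, hE⟩ : Closeds G) ≤
      Scheme.IdealSheafData.vanishingIdeal (⟨Z, hZ⟩ : Closeds G) :=
    Scheme.IdealSheafData.vanishingIdeal_antimono (show (⟨Z, hZ⟩ : Closeds G) ≤ ⟨E, hE⟩ from hZE)
  obtain ⟨i, hi⟩ : ∃ i : redSub G Z hZ ⟶ redSub G E hE, i ≫ redSubι G E hE = redSubι G Z hZ :=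
    ⟨Scheme.IdealSheafData.inclusion hle, Scheme.IdealSheafData.inclusion_subschemeι hle⟩
  -- the square `i ≫ ε = εZ ≫ i₁` (test against the monomorphism `Ẽ₁ ⟶ G₁`)
  have hsq : i ≫ (asIso ε).hom = (asIso εZ).hom ≫ i₁ := by
    rw [asIso_hom, asIso_hom, ← cancel_mono (redSubι G₁ E₁ hE₁), Category.assoc, hεcomm, ← Category.assoc, hi,
      Category.assoc, hi₁, hεZcomm]
  -- the unobstructedness datum on the current stage, for this `i`
  obtain ⟨V, hVaff, hV01, hVtop, hsub⟩ := hunobs i hi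
  -- the transported cover of `Γ̃₁`
  refine ⟨preimageFamily (asIso εZ).inv V, fun j => (hVaff j).preimage_of_isIso (asIso εZ).inv,
    hV01.preimage_of_isIso (asIso εZ).inv, Scheme.Hom.iSup_preimage_eq_top _ hVtop, ?_⟩
  -- the transported vanishing
  obtain ⟨e𝒩⟩ := nonempty_pushforward_normalSheaf_iso hsq
  exact subsingleton_cechMH1_of_schemeIso ((asIso εZ).hom ≫ (redSub G₁ Γ₁ hΓ₁).toSpecΓ) (normalSheaf i) V (asIso εZ)
    (redSub G₁ Γ₁ hΓ₁).toSpecΓ (by rw [Iso.inv_hom_id_assoc]) e𝒩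
    ((subsingleton_cechMH1_iff_of_base (redSub G Z hZ).toSpecΓ (normalSheaf i) V _).mp hsub)

end Summit.ResolutionOfSingularities.ResolutionOfSingularities.Cruxes.EquisingularLiftNat.Sections

end
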